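import Summits.PneNP.PneNP.Theorems.ChebyshevTracialDesignVirtualBimode
import Summits.PneNP.PneNP.Theorems.ChebyshevTracialDesignSpectralNonTightnessWide
import HarnessLib

/-!
# Cell pnp-psdrank, route `ChebyshevTracialDesign`: VIRTUAL NONNEGATIVITY OF SPREAD CELLS (VNS), modulo Keevash–Lifshitz Thm 1.8 —
# a dense family of `t`-cuts against a dense homogeneous family of perfect matchings has design value `≤ B·√(P_D μν)`, tight-free or not

Harmonic backbone of the crux `TracialDecayExp20` (stmt-PneNP-19878), brick 46 (prover g10; MEMO-12 §3 «next prover (0)»: the replacement of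
the SNT CONTRADICTION of the `r = 1` rung by a DIRECT estimate, needed for NTF = decay of `W·(cc−1)²` on ALL rectangles, lit g16 I15).
Assume the named fact `GlobalLevelDInequality` [cite: KeevashLifshitz2023, Thm. 1.8]. For `τ ≥ 1` there are `c₀ > 0`, `n₁` with: for even
`n ≥ n₁`, `t = 2c'+1` with `2t ≤ n ≤ 5t`, every family `X` of `t`-subsets with `μ = |X|/C(n,t) ≥ exp(−c₀ dq n)` (NO spreadness asked of `X`)
and every `(PM_n, τ)`-homogeneous set `Y` of perfect matchings with `ν ≥ exp(−c₀ dq n)`: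
* §1 **`head_layerBound_of_globalLevelD`** — SNT's head estimate WITHOUT tight-freeness: for every harmonic layer decomposition `p` of `1_X`
  and `1 ≤ κ ≤ min(c', dq n + 8)`: `|T_{2κ}(X,Y)|/(|PM|·N₁) ≤ 4μν·16^{−κ}` (bricks 27–29: slice level-`2κ` inequality (F1) on the `X` side,
  Keevash–Lifshitz / Parseval on the `Y` side, tight attenuation; the proof of brick 29 `snt_wide_of_globalLevelD` minus its last line);
* §2 **`virtual_nonneg_spread_of_globalLevelD`** — with brick 45 (`…VirtualBimode.virtual_rectangle_ge`): for `D + 2 ≤ 2c'`, `D ≤ 2(dq n + 8)`,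
  the VIRTUAL VALUE `(1/|PM|)·Σ_{M∈Y} Ẽ_M[(1_X)_{≤D}]` is `≥ (3/7)·μν ≥ 0`;
* §3 **`spreadCell_value_le_of_globalLevelD`** — hence for every exact design `(n, t, T, D, B, C, w)` (degree `D + 2 ≤ 2c'`, `D ≤ 2(dq n+8)`,
  ANY variation bound `B`) the design value of the rectangle is `Σ_{U∈A} Σ_{M∈Y} W(U,M) ≤ B·√(P_D·μ·ν)` (`A` = `X` as `t`-cuts) — for a
  tight-free dense spread cell SNT says the cell does not exist; for an ARBITRARY dense spread cell the constant mode `+μν` of the virtual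
  value wins over the head modes (`Σ_κ 2^κ·4μν·16^{−κ} ≤ (4/7)μν`) and the value is `−Virt + tail ≤ tail` (MEMO-12 §4(d), answered).
[cite: KeevashLifshitz2023, Thm. 1.8] [cite: KupavskiiZakharov2022, §2] [cite: Rothvoss2017, §2 (PDF p. 6)] [cite: Grigoriev2001, Lemma 1.4 (PDF p. 8)]
[cite: ODonnell2014, §9.5]
Stature: support/instrument, CONDITIONAL on `GlobalLevelDInequality` (binder only). WHAT THIS IS NOT: not NTF itself (the Kupavskii–Zakharov
pieces, crossing cells and reduced instances come next), not the crux, nothing on psd rank, no P-vs-NP content. Supports stmt-PneNP-19878.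
-/

set_option linter.dupNamespace false -- `Summit.PneNP.PneNP.…`: summit = sub-problem (D-0017)

noncomputable section

namespace Summit.PneNP.PneNP.Theorems.ChebyshevTracialDesignVirtualNonnegSpread

open Finset Literature.Barriers.PneNP Literature.Computability.Complexity Literature.Combinatorics.Optimization
open Literature.Combinatorics.AssociationSchemes Literature.Combinatorics.AssociationSchemes.JohnsonHarmonics
open Literature.Combinatorics.AssociationSchemes.JohnsonSpectrum
open Literature.Combinatorics.AssociationSchemes.HomogeneousMatchingFamilies
open Literature.Combinatorics.SetFamily
open Literature.Combinatorics.SimpleGraph.CycleSpace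
open Literature.Combinatorics.Additive.KeevashLifshitz
open Summit.PneNP.PneNP.Theorems.ChebyshevTracialDesignTightFreeSpectral
open Summit.PneNP.PneNP.Theorems.ChebyshevTracialDesignTightColumnSums
open Summit.PneNP.PneNP.Theorems.ChebyshevTracialDesignProfilePolynomial (card_pmatch_pos)
open Summit.PneNP.PneNP.Theorems.ChebyshevTracialDesignSpectralNonTightnessLayers
open Summit.PneNP.PneNP.Theorems.ChebyshevTracialDesignSpectralNonTightnessEstimates
open Summit.PneNP.PneNP.Theorems.ChebyshevTracialDesignSpectralNonTightnessWide
open Summit.PneNP.PneNP.Theorems.ChebyshevTracialDesignVirtualBimode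

variable {n : ℕ}

/-! ### §1 SNT's head estimate, without tight-freeness -/

/-- **The head estimate of spectral non-tightness, for ARBITRARY dense `X` and homogeneous dense `Y` (no tight-freeness).** Under
`GlobalLevelDInequality`, for every `τ ≥ 1` there are `c₀ > 0` and `n₁` such that for even `n ≥ n₁`, `t = 2c'+1` with `2t ≤ n ≤ 5t`, every
family `X` of `t`-subsets with `|X|/C(n,t) ≥ exp(−c₀·dq n)` and EVERY harmonic layer decomposition `p` of its indicator, every
`(PM_n, τ)`-homogeneous `Y` with `|Y|/|PM_n| ≥ exp(−c₀·dq n)`, and every `1 ≤ κ ≤ c'` with `κ ≤ dq n + 8`: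
`|T_{2κ}(X,Y)| / (|PM_n|·N₁) ≤ 4·μ(X)·ν(Y)·16^{−κ}`. [cite: KeevashLifshitz2023, Thm. 1.8] [cite: ODonnell2014, §9.5] [cite: Rothvoss2017, §2 (PDF p. 6)] -/
theorem head_layerBound_of_globalLevelD (hKL : GlobalLevelDInequality) {τ : ℝ} (hτ : 1 ≤ τ) :
    ∃ c₀ : ℝ, 0 < c₀ ∧ c₀ ≤ 1 ∧ ∃ n₁ : ℕ, ∀ (n c' : ℕ), n₁ ≤ n → Even n → 2 * (2 * c' + 1) ≤ n → n ≤ 5 * (2 * c' + 1) →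
      ∀ (X : Finset (Finset (Fin n))), X ⊆ univ.powersetCard (2 * c' + 1) →
      ∀ (p : ℕ → Finset (Fin n) → ℝ), (∀ j, IsHarmonic j (p j)) →
        (∀ U ∈ univ.powersetCard (2 * c' + 1),
          (if U ∈ X then (1 : ℝ) else 0) = (∑ j ∈ range (2 * c' + 1 + 1), up^[2 * c' + 1 - j] (p j)) U) →
      ∀ (Y : Finset (PMatch n)), IsRelHomogeneous τ (perfectMatchings (univ : Finset (Fin n))) (Y.image Subtype.val) →
      Real.exp (-(c₀ * dq n)) ≤ (X.card : ℝ) / (n.choose (2 * c' + 1) : ℝ) →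
      Real.exp (-(c₀ * dq n)) ≤ (Y.card : ℝ) / (Fintype.card (PMatch n) : ℝ) →
      ∀ κ : ℕ, 1 ≤ κ → κ ≤ c' → κ ≤ dq n + 8 →
        |∑ M ∈ Y, ∑ U ∈ univ.powersetCard (2 * c' + 1),
            (up^[2 * c' + 1 - 2 * κ] (p (2 * κ))) U * (if (U.filter fun x => M.2.partner x ∉ U).card = 1 then (1 : ℝ) else 0)| /
            ((Fintype.card (PMatch n) : ℝ) * ((((n / 2).choose (1 + c') * (1 + c').choose c' * 2 ^ 1 : ℕ) : ℝ))) ≤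
          4 * ((X.card : ℝ) / (n.choose (2 * c' + 1) : ℝ)) * ((Y.card : ℝ) / (Fintype.card (PMatch n) : ℝ)) * (1 / 16) ^ κ := by
  obtain ⟨C, hC, hKLb⟩ := abs_layerCorr_even_le_KL hKL
  have hτ0 : 0 < τ := one_pos.trans_le hτ
  have hc₁pos : 0 < 1 / (2736 * C * τ ^ 2) := by positivity
  refine ⟨min 1 (1 / (2736 * C * τ ^ 2)), lt_min one_pos hc₁pos, min_le_left _ _, (2 * 10 ^ 8) ^ 4, ?_⟩
  intro n c' hn₁ hn ht hbal X hX p hp hdec Y hhom hμ hν κ hκ1 hκc hκD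
  have hc₀0 : 0 < min 1 (1 / (2736 * C * τ ^ 2)) := lt_min one_pos hc₁pos
  have hc₀1 : min 1 (1 / (2736 * C * τ ^ 2)) ≤ 1 := min_le_left _ _
  have hc₀C : min 1 (1 / (2736 * C * τ ^ 2)) ≤ 1 / (2736 * C * τ ^ 2) := min_le_right _ _
  -- the size parameter `D = dq n ≥ 2·10⁸`, `D⁴ ≤ n`
  have hD : 2 * 10 ^ 8 ≤ dq n := by
    unfold dq
    rw [Nat.le_sqrt, Nat.le_sqrt]
    calc 2 * 10 ^ 8 * (2 * 10 ^ 8) * (2 * 10 ^ 8 * (2 * 10 ^ 8)) = (2 * 10 ^ 8) ^ 4 := by norm_num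
      _ ≤ n := hn₁
  have hD4n : dq n ^ 4 ≤ n := by
    have h1 : dq n * dq n ≤ Nat.sqrt n := Nat.sqrt_le (Nat.sqrt n)
    calc dq n ^ 4 = (dq n * dq n) * (dq n * dq n) := by ring
      _ ≤ Nat.sqrt n * Nat.sqrt n := Nat.mul_le_mul h1 h1
      _ ≤ n := Nat.sqrt_le n
  have hD2 : dq n * dq n ≤ dq n ^ 4 := by
    calc dq n * dq n = dq n * dq n * 1 := (mul_one _).symm
      _ ≤ dq n * dq n * (dq n * dq n) := Nat.mul_le_mul_left _ (Nat.one_le_iff_ne_zero.2 (by positivity))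
      _ = dq n ^ 4 := by ring
  have h100 : 100 ≤ n := by
    have : 100 ≤ dq n * dq n := by nlinarith
    omega
  have h32 : 32 * (dq n + 8) ≤ n := by
    have : 32 * (dq n + 8) ≤ dq n * dq n := by nlinarith
    omega
  obtain ⟨κ₁, hA1⟩ := exists_tightGram_classFunction (n := n) (t := 2 * c' + 1) ⟨c', rfl⟩
  -- densities
  have hPMpos : (0 : ℝ) < Fintype.card (PMatch n) := by exact_mod_cast card_pmatch_pos hn
  have hCnpos : (0 : ℝ) < (n.choose (2 * c' + 1) : ℝ) := by exact_mod_cast Nat.choose_pos (by omega)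
  have hN1pos : (0 : ℝ) < ((((n / 2).choose (1 + c') * (1 + c').choose c' * 2 ^ 1 : ℕ) : ℝ)) := by
    have h1 : 0 < (n / 2).choose (1 + c') := Nat.choose_pos (by omega)
    have h2 : 0 < (1 + c').choose c' := Nat.choose_pos (by omega)
    positivity
  have hμ1 : (X.card : ℝ) / (n.choose (2 * c' + 1) : ℝ) ≤ 1 := by
    rw [div_le_one hCnpos]
    have := card_le_card hX
    rw [card_powersetCard, card_univ, Fintype.card_fin] at this
    exact_mod_cast this
  have hν1 : (Y.card : ℝ) / (Fintype.card (PMatch n) : ℝ) ≤ 1 := by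
    rw [div_le_one hPMpos]
    exact_mod_cast (card_le_univ Y).trans_eq Finset.card_univ
  -- the head term `κ`
  have h4κn : 4 * κ ≤ n := by omega
  have h32κn : 16 * (2 * κ) ≤ n := by omega
  have hL := ladder_ip_le_level' (t := 2 * c' + 1) (j := 2 * κ) h100 hbal (by omega) (by omega) h32κn X hX p hp hdec
  have hLq : ip (up^[2 * c' + 1 - 2 * κ] (p (2 * κ))) (up^[2 * c' + 1 - 2 * κ] (p (2 * κ))) / (n.choose (2 * c' + 1) : ℝ) ≤
      16 * ((X.card : ℝ) / (n.choose (2 * c' + 1) : ℝ)) ^ 2 *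
        (48 * (Real.exp 1 * (2 * Real.log (1 / ((X.card : ℝ) / (n.choose (2 * c' + 1) : ℝ))) / ((2 * κ : ℕ) : ℝ) + 3))) ^
          (2 * κ) := by
    rw [div_le_iff₀ hCnpos]
    calc ip (up^[2 * c' + 1 - 2 * κ] (p (2 * κ))) (up^[2 * c' + 1 - 2 * κ] (p (2 * κ)))
        ≤ 16 * (n.choose (2 * c' + 1) : ℝ) * ((X.card : ℝ) / (n.choose (2 * c' + 1) : ℝ)) ^ 2 *
          (48 * (Real.exp 1 * (2 * Real.log (1 / ((X.card : ℝ) / (n.choose (2 * c' + 1) : ℝ))) / ((2 * κ : ℕ) : ℝ) + 3))) ^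
            (2 * κ) := hL
      _ = 16 * ((X.card : ℝ) / (n.choose (2 * c' + 1) : ℝ)) ^ 2 *
          (48 * (Real.exp 1 * (2 * Real.log (1 / ((X.card : ℝ) / (n.choose (2 * c' + 1) : ℝ))) / ((2 * κ : ℕ) : ℝ) + 3))) ^
            (2 * κ) * (n.choose (2 * c' + 1) : ℝ) := by ring
  exact head_term_abstract hC hτ hc₀0 hc₀1 hc₀C hD hD4n hκ1 hκD (mul_pos hPMpos hN1pos) (atten_le_pow h4κn)
    (div_nonneg (ip_self_nonneg _) hCnpos.le) hLq hμ hμ1 hν hν1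
    (fun h8 h5 => hKLb n c' κ hn ht hκ1 hκc Y τ hτ hhom h8 h5 p hp κ₁ hA1)
    (abs_layerCorr_even_le_parseval hn ht hκc Y p hp κ₁ hA1)

/-! ### §2 Virtual nonnegativity of dense spread cells -/

/-- **VIRTUAL NONNEGATIVITY OF SPREAD CELLS (mod KL).** Under `GlobalLevelDInequality`, for every `τ ≥ 1` there are `c₀ ∈ (0,1]` and `n₁`
such that for even `n ≥ n₁`, `t = 2c'+1` with `2t ≤ n ≤ 5t`, every truncation degree `D` with `D + 2 ≤ 2c'` and `D ≤ 2(dq n + 8)`, every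
family `X` of `t`-subsets with `μ(X) ≥ exp(−c₀ dq n)` and harmonic layers `p` of its indicator, and every `(PM_n,τ)`-homogeneous `Y` with
`ν(Y) ≥ exp(−c₀ dq n)`: the averaged Grigoriev pseudo-expectation of the low part is bounded BELOW,
`(1/|PM|)·Σ_{M∈Y} Ẽ_M[(1_X)_{≤D}] ≥ (3/7)·μ(X)·ν(Y)`. [cite: KeevashLifshitz2023, Thm. 1.8] [cite: Grigoriev2001, Lemma 1.4 (PDF p. 8)]
[cite: Rothvoss2017, §2 (PDF p. 6)] -/
theorem virtual_nonneg_spread_of_globalLevelD (hKL : GlobalLevelDInequality) {τ : ℝ} (hτ : 1 ≤ τ) :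
    ∃ c₀ : ℝ, 0 < c₀ ∧ c₀ ≤ 1 ∧ ∃ n₁ : ℕ, ∀ (n c' D : ℕ), n₁ ≤ n → Even n → 2 * (2 * c' + 1) ≤ n → n ≤ 5 * (2 * c' + 1) →
      D + 2 ≤ 2 * c' → D ≤ 2 * (dq n + 8) →
      ∀ (X : Finset (Finset (Fin n))), X ⊆ univ.powersetCard (2 * c' + 1) →
      ∀ (p : ℕ → Finset (Fin n) → ℝ), (∀ j, IsHarmonic j (p j)) →
        (∀ U ∈ univ.powersetCard (2 * c' + 1),
          (if U ∈ X then (1 : ℝ) else 0) = (∑ j ∈ range (2 * c' + 1 + 1), up^[2 * c' + 1 - j] (p j)) U) →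
      ∀ (Y : Finset (PMatch n)), IsRelHomogeneous τ (perfectMatchings (univ : Finset (Fin n))) (Y.image Subtype.val) →
      Real.exp (-(c₀ * dq n)) ≤ (X.card : ℝ) / (n.choose (2 * c' + 1) : ℝ) →
      Real.exp (-(c₀ * dq n)) ≤ (Y.card : ℝ) / (Fintype.card (PMatch n) : ℝ) →
        (3 / 7 : ℝ) * (((X.card : ℝ) / (n.choose (2 * c' + 1) : ℝ)) * ((Y.card : ℝ) / (Fintype.card (PMatch n) : ℝ))) ≤
          (Fintype.card (PMatch n) : ℝ)⁻¹ * ∑ M ∈ Y, ∑ A : {A : Finset (Fin n) // A.card ≤ D},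
            (∑ j ∈ range (2 * c' + 1 + 1), ((2 * c' + 1 - j).factorial : ℝ) • (if D < j then 0 else p j)) A.1 *
              knapsackMoment M.1.card (((2 * c' + 1 : ℕ) : ℝ) / 2) (M.1.filter fun e => ∃ a ∈ A.1, a ∈ e).card := by
  obtain ⟨c₀, hc₀, hc₀1, n₁, hhead⟩ := head_layerBound_of_globalLevelD hKL hτ
  refine ⟨c₀, hc₀, hc₀1, n₁, ?_⟩
  intro n c' D hn₁ hn ht hbal hD2 hDq X hX p hp hdec Y hhom hμ hν
  have hvirt := virtual_rectangle_ge hn ht hD2 X hX Y p hp hdec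
  set μ : ℝ := (X.card : ℝ) / (n.choose (2 * c' + 1) : ℝ) with hμdef
  set ν : ℝ := (Y.card : ℝ) / (Fintype.card (PMatch n) : ℝ) with hνdef
  have hμ0 : 0 ≤ μ := by positivity
  have hν0 : 0 ≤ ν := by positivity
  have hheadsum : ∑ κ ∈ Icc 1 (D / 2), (2 : ℝ) ^ κ *
      (|∑ M ∈ Y, ∑ U ∈ univ.powersetCard (2 * c' + 1),
          (up^[2 * c' + 1 - 2 * κ] (p (2 * κ))) U * (if (U.filter fun x => M.2.partner x ∉ U).card = 1 then (1 : ℝ) else 0)| /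
        ((Fintype.card (PMatch n) : ℝ) * ((((n / 2).choose (1 + c') * (1 + c').choose c' * 2 ^ 1 : ℕ) : ℝ)))) ≤
      4 * μ * ν * (1 / 7) := by
    calc _ ≤ ∑ κ ∈ Icc 1 (D / 2), (2 : ℝ) ^ κ * (4 * μ * ν * (1 / 16) ^ κ) :=
          sum_le_sum fun κ hκ => by
            obtain ⟨hκ1, hκD⟩ := mem_Icc.1 hκ
            exact mul_le_mul_of_nonneg_left
              (hhead n c' hn₁ hn ht hbal X hX p hp hdec Y hhom hμ hν κ hκ1 (by omega) (by omega)) (by positivity)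
      _ = 4 * μ * ν * ∑ κ ∈ Icc 1 (D / 2), ((1 : ℝ) / 8) ^ κ := by
          rw [mul_sum]
          refine sum_congr rfl fun κ _ => ?_
          rw [show ((1 : ℝ) / 8) ^ κ = (2 : ℝ) ^ κ * (1 / 16) ^ κ by rw [← mul_pow]; norm_num]
          ring
      _ ≤ 4 * μ * ν * (1 / 7) := by
          refine mul_le_mul_of_nonneg_left ?_ (by positivity)
          have hsub : Icc 1 (D / 2) ⊆ Ico 1 (D / 2 + 1) := by
            intro κ hκ; rw [mem_Ico]; have := mem_Icc.1 hκ; omega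
          calc ∑ κ ∈ Icc 1 (D / 2), ((1 : ℝ) / 8) ^ κ ≤ ∑ κ ∈ Ico 1 (D / 2 + 1), ((1 : ℝ) / 8) ^ κ :=
                sum_le_sum_of_subset_of_nonneg hsub fun κ _ _ => by positivity
            _ ≤ ((1 : ℝ) / 8) ^ 1 / (1 - 1 / 8) := geom_sum_Ico_le_of_lt_one (by norm_num) (by norm_num)
            _ ≤ 1 / 7 := by norm_num
  linarith

/-! ### §3 The design value of a dense spread cell -/

/-- **THE DESIGN VALUE OF A DENSE SPREAD CELL, no tight-freeness (mod KL).** Under `GlobalLevelDInequality`, for every `τ ≥ 1` there are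
`c₀ ∈ (0,1]` and `n₁` such that: for even `n ≥ n₁`, every exact design `(n, t = 2c'+1, T, D, B, C, w)` with `n ≤ 5t`, `D + 2 ≤ 2c'`,
`D ≤ 2(dq n + 8)` (ANY variation bound `B`), every family `A` of `t`-cuts with `|A|/C(n,t) ≥ exp(−c₀ dq n)` and every `(PM_n,τ)`-homogeneous
`Y` with `|Y|/|PM_n| ≥ exp(−c₀ dq n)`:  `Σ_{U∈A} Σ_{M∈Y} W(U,M) ≤ B · √(P_D · (|A|/C(n,t)) · (|Y|/|PM_n|))`, `P_D = Π_{i ≤ D/2}(2i+1)/(n−2i)`.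
The one-sided replacement of SNT for the non-tight-free `r = 1` rung (NTF). [cite: KeevashLifshitz2023, Thm. 1.8] [cite: Rothvoss2017, §2 (PDF p. 6)]
[cite: Grigoriev2001, Lemma 1.4 (PDF p. 8)] [cite: KupavskiiZakharov2022, §2] -/
theorem spreadCell_value_le_of_globalLevelD (hKL : GlobalLevelDInequality) {τ : ℝ} (hτ : 1 ≤ τ) :
    ∃ c₀ : ℝ, 0 < c₀ ∧ c₀ ≤ 1 ∧ ∃ n₁ : ℕ, ∀ (n c' T D : ℕ) (Bv : ℝ) (C : Finset ℕ) (w : ℕ → ℝ), n₁ ≤ n → Even n →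
      IsExactDesign n (2 * c' + 1) T D Bv C w → n ≤ 5 * (2 * c' + 1) → D + 2 ≤ 2 * c' → D ≤ 2 * (dq n + 8) →
      ∀ (A : Finset (OddSet n)), (∀ U ∈ A, U.1.card = 2 * c' + 1) →
      ∀ (Y : Finset (PMatch n)), IsRelHomogeneous τ (perfectMatchings (univ : Finset (Fin n))) (Y.image Subtype.val) →
      Real.exp (-(c₀ * dq n)) ≤ (A.card : ℝ) / (n.choose (2 * c' + 1) : ℝ) →
      Real.exp (-(c₀ * dq n)) ≤ (Y.card : ℝ) / (Fintype.card (PMatch n) : ℝ) →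
        ∑ U ∈ A, ∑ M ∈ Y, levelWeight n (2 * c' + 1) C w U M ≤
          Bv * Real.sqrt ((∏ i ∈ range (D / 2 + 1), ((2 * i + 1 : ℝ) / ((n : ℝ) - 2 * i))) *
            ((A.card : ℝ) / (n.choose (2 * c' + 1) : ℝ)) * ((Y.card : ℝ) / (Fintype.card (PMatch n) : ℝ))) := by
  classical
  obtain ⟨c₀, hc₀, hc₀1, n₁, hhead⟩ := head_layerBound_of_globalLevelD hKL hτ
  refine ⟨c₀, hc₀, hc₀1, n₁, ?_⟩
  intro n c' T D Bv C w hn₁ hn hdes hbal hD2 hDq A hA Y hhom hμ hν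
  have ht : 2 * (2 * c' + 1) + 2 ≤ n := hdes.2.1
  -- `A` as a family of `t`-subsets and its harmonic layer decomposition
  set X : Finset (Finset (Fin n)) := A.image Subtype.val with hXdef
  have hX : X ⊆ univ.powersetCard (2 * c' + 1) := by
    intro U hU
    obtain ⟨U', hU', rfl⟩ := mem_image.1 hU
    exact mem_powersetCard_univ.2 (hA U' hU')
  have hcard : (X.card : ℝ) = A.card := by rw [hXdef, card_image_of_injective _ Subtype.val_injective]
  have hhomog : IsHomog (2 * c' + 1) (fun U : Finset (Fin n) => if U ∈ X then (1 : ℝ) else 0) := by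
    intro S hS
    simp only
    rw [if_neg]
    intro hSX
    exact hS (mem_powersetCard.1 (hX hSX)).2
  obtain ⟨p, hp, hpeq⟩ := exists_ladder_decomposition (by omega : 2 * (2 * c' + 1) ≤ n + 1) hhomog
  have hdec : ∀ U ∈ univ.powersetCard (2 * c' + 1),
      (if U ∈ X then (1 : ℝ) else 0) = (∑ j ∈ range (2 * c' + 1 + 1), up^[2 * c' + 1 - j] (p j)) U :=
    fun U _ => congrFun hpeq U
  have hμ' : Real.exp (-(c₀ * dq n)) ≤ (X.card : ℝ) / (n.choose (2 * c' + 1) : ℝ) := by rw [hcard]; exact hμ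
  have key := rectangle_value_le_tail_of_layerBounds hn hdes hD2 X hX Y p hp hdec (fun κ hκ => by
    obtain ⟨hκ1, hκD⟩ := mem_Icc.1 hκ
    exact hhead n c' hn₁ hn (by omega) hbal X hX p hp hdec Y hhom hμ' hν κ hκ1 (by omega) (by omega))
  rw [hcard] at key
  -- the indicator-weighted sum is the sum over `A`
  have hsum : ∑ U : OddSet n, ∑ M ∈ Y, levelWeight n (2 * c' + 1) C w U M * (if U.1 ∈ X then (1 : ℝ) else 0) =
      ∑ U ∈ A, ∑ M ∈ Y, levelWeight n (2 * c' + 1) C w U M := by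
    have hmem : ∀ U : OddSet n, U.1 ∈ X ↔ U ∈ A := by
      intro U
      rw [hXdef, mem_image]
      constructor
      · rintro ⟨U', hU', h⟩; rwa [← Subtype.ext h]
      · intro hU; exact ⟨U, hU, rfl⟩
    rw [← sum_filter_add_sum_filter_not univ (fun U : OddSet n => U ∈ A)]
    have h0 : ∑ U ∈ univ.filter (fun U : OddSet n => ¬U ∈ A), ∑ M ∈ Y,
        levelWeight n (2 * c' + 1) C w U M * (if U.1 ∈ X then (1 : ℝ) else 0) = 0 :=
      sum_eq_zero fun U hU => by
        have : ¬U.1 ∈ X := fun h => (mem_filter.1 hU).2 ((hmem U).1 h)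
        simp [this]
    rw [h0, add_zero, show univ.filter (fun U : OddSet n => U ∈ A) = A by ext U; simp]
    refine sum_congr rfl fun U hU => sum_congr rfl fun M _ => ?_
    rw [if_pos ((hmem U).2 hU), mul_one]
  rw [hsum] at key
  exact key

end Summit.PneNP.PneNP.Theorems.ChebyshevTracialDesignVirtualNonnegSpread
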